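import Mathlib
import HarnessLib
import Literature.MathematicalPhysics.QuantumManyBody.RelativeFisherInformation
import Literature.MathematicalPhysics.QuantumManyBody.CouplingPathSliceFloor
import Literature.MathematicalPhysics.QuantumManyBody.OneBodyCurrentGain
import Literature.MathematicalPhysics.QuantumManyBody.PeriodicClusteringFromKyFanGap

/-!
# Route `BECFisherTransfer` — support `GroundStateRepresentation` (stmt-AtomisticToContinuum-14305):
# measurable minorants, real forms and the variational inequality for weighted energies

Helper file of `BECFisherTransferGroundStateRepresentation.lean` (the ground-state representation
`periodicEnergy v Φ = E₀^per + ¼ I_{cell}(P_Φ‖P_Ψ₀)` on the torus). Contents: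

* `exists_measurable_minorant` — for an *arbitrary* (possibly non-measurable) weight `F ≥ 0` with
  `∫⁻ F p < ∞` against a measurable `0 < p < ∞`, a measurable finite `G ≤ F` with
  `∫⁻ F a = ∫⁻ G a` for every measurable finite `a` (lower Lebesgue integrals); whence
  `exists_measurable_weight`: the periodic energy of every admissible periodic state, for an
  arbitrary pair-potential profile `v`, is a `G`-weighted energy `∫⁻_{cell} (|∇Ψ|² + G|Ψ|²)` with
  `G` measurable and finite, as soon as one nowhere-vanishing state has finite potential energy;
* pointwise algebra for complexified real amplitudes (`kineticDensity_ofReal_eq`,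
  `relFisherDensity_eq_ofReal`, the expansion `gradDot_add_mul_self` and Jacobi's identity
  `gradDot_mul_self_eq`: `|∇(hψ)|² = ψ²|∇h|² + ∇(h²ψ)·∇ψ`);
* real (Bochner) forms of the weighted energy and of the mass on the cell
  (`weightedForm_ofReal_eq`, `mass_ofReal_eq`, `integrableOn_weight_mul`);
* the variational inequality `E₀ ∫⁻|ψ|² ≤ ∫⁻ (|∇ψ|² + W|ψ|²)` for unnormalised admissible `ψ`
  when `E₀` bounds the weighted energy of admissible states from below
  (`lowerBound_mul_mass_le`, `toReal_lowerBound_mul_le`), and the elementary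
  `integral_quadratic_expand`.

References: [LSSY2005] (6.26)–(6.28); [AlbeverioHoeghkrohnStreit1977]; [RezakhanlouVillani2008]
Part I §1.3.1; [Fournais2020] (1.1)–(1.2).
-/
noncomputable section

open MeasureTheory Filter Set
open scoped ENNReal NNReal Topology BigOperators

namespace Summit.AtomisticToContinuum.BoseEinsteinCondensation.Theorems

open Literature.MathematicalPhysics.QuantumManyBody.BoseGas

namespace FisherGroundStateRepresentation

/-! ### Measurable minorant of an arbitrary weight -/

/-- **Measurable minorant of an arbitrary weight.** Let `F ≥ 0` be an *arbitrary* (possibly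
non-measurable) `ℝ≥0∞`-valued function and `p` a measurable weight with `0 < p < ∞` pointwise and
`∫⁻ F p < ∞` (lower Lebesgue integral). Then there is a measurable, finite `G ≤ F` such that
`∫⁻ F a = ∫⁻ G a` for *every* measurable finite `a ≥ 0`: lower integrals against the
non-measurable `F` are honest integrals against its measurable minorant `G`. [folklore] -/
theorem exists_measurable_minorant {α : Type*} [MeasurableSpace α] (μ : Measure α)
    (F : α → ℝ≥0∞) {p : α → ℝ≥0∞} (hp : Measurable p) (hp0 : ∀ x, p x ≠ 0)
    (hptop : ∀ x, p x ≠ ⊤) (hfin : ∫⁻ x, F x * p x ∂μ ≠ ⊤) :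
    ∃ G : α → ℝ≥0∞, Measurable G ∧ (∀ x, G x ≤ F x) ∧ (∀ x, G x ≠ ⊤) ∧
      ∀ a : α → ℝ≥0∞, Measurable a → (∀ x, a x ≠ ⊤) →
        ∫⁻ x, F x * a x ∂μ = ∫⁻ x, G x * a x ∂μ := by
  obtain ⟨φ, hφm, hφle, hφeq⟩ := exists_measurable_le_lintegral_eq μ fun x => F x * p x
  have hGle : ∀ x, ((φ x / p x).toNNReal : ℝ≥0∞) ≤ F x := fun x =>
    calc ((φ x / p x).toNNReal : ℝ≥0∞) ≤ φ x / p x := ENNReal.coe_toNNReal_le_self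
      _ ≤ F x * p x / p x := by gcongr; exact hφle x
      _ = F x := ENNReal.mul_div_cancel_right (hp0 x) (hptop x)
  refine ⟨fun x => ((φ x / p x).toNNReal : ℝ≥0∞), (hφm.div hp).ennreal_toNNReal.coe_nnreal_ennreal,
    hGle, fun x => ENNReal.coe_ne_top, fun a ha hatop => ?_⟩
  refine le_antisymm ?_ (lintegral_mono fun x => mul_le_mul' (hGle x) le_rfl)
  rw [← iSup_lintegral_measurable_le_eq_lintegral]
  refine iSup_le fun g => iSup_le fun hg => iSup_le fun hgle => ?_
  -- `g' = g / a ≤ F`, so `max φ (g' p) ≤ F p` has the same (finite) integral as `φ`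
  have hg'le : ∀ x, g x / a x ≤ F x := fun x => ENNReal.div_le_of_le_mul (hgle x)
  set ψ : α → ℝ≥0∞ := fun x => max (φ x) (g x / a x * p x) with hψ
  have hψm : Measurable ψ := hφm.max ((hg.div ha).mul hp)
  have hψle : ∀ x, ψ x ≤ F x * p x := fun x =>
    max_le (hφle x) (mul_le_mul' (hg'le x) le_rfl)
  have hφψ : φ =ᵐ[μ] ψ := by
    refine ae_eq_of_ae_le_of_lintegral_le (ae_of_all _ fun x => le_max_left _ _)
      (hφeq ▸ hfin) hψm.aemeasurable ?_
    rw [← hφeq]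
    exact lintegral_mono hψle
  have hφtop : ∀ᵐ x ∂μ, φ x < ⊤ := ae_lt_top hφm (hφeq ▸ hfin)
  refine lintegral_mono_ae ?_
  filter_upwards [hφψ, hφtop] with x hx hxtop
  have h1 : g x / a x * p x ≤ φ x := by
    rw [hx]
    exact le_max_right _ _
  have h2 : g x / a x ≤ φ x / p x := by
    rw [ENNReal.le_div_iff_mul_le (Or.inl (hp0 x)) (Or.inl (hptop x))]
    exact h1
  have h3 : ((φ x / p x).toNNReal : ℝ≥0∞) = φ x / p x :=
    ENNReal.coe_toNNReal (ENNReal.div_ne_top hxtop.ne (hp0 x))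
  rw [h3]
  by_cases ha0 : a x = 0
  · have : g x = 0 := by
      have := hgle x
      simpa only [ha0, mul_zero, nonpos_iff_eq_zero] using this
    rw [this]
    exact zero_le
  · calc g x = g x / a x * a x := (ENNReal.div_mul_cancel ha0 (hatop x)).symm
      _ ≤ φ x / p x * a x := mul_le_mul' h2 le_rfl


/-! ### Pointwise algebra: real amplitudes, product rules -/

variable {N : ℕ}

/-- `(‖(r : ℂ)‖₊)² = ofReal (r²)` for real `r`. [folklore] -/
theorem coe_nnnorm_ofReal_sq (r : ℝ) : ((‖((r : ℝ) : ℂ)‖₊ : ℝ≥0∞) ^ 2) = ENNReal.ofReal (r ^ 2) := by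
  rw [coe_nnnorm_sq_eq_ofReal, Complex.norm_real, Real.norm_eq_abs, sq_abs]

/-- The squared gradient of a real function in `ℝ≥0∞` form is its carré du champ:
`∑_{i,k} ‖∂_{i,k} f‖₊² = ofReal (∇f·∇f)`. [folklore] -/
theorem sum_nnnorm_fderiv_sq_eq (f : Config N → ℝ) (X : Config N) :
    (∑ i : Fin N, ∑ k : Fin 3,
      (‖fderiv ℝ f X (Pi.single i (EuclideanSpace.single k (1 : ℝ)))‖₊ : ℝ≥0∞) ^ 2) =
      ENNReal.ofReal (gradDot f f X) := by
  unfold gradDot pderiv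
  rw [ENNReal.ofReal_sum_of_nonneg (fun i _ => Finset.sum_nonneg fun k _ => mul_self_nonneg _)]
  refine Finset.sum_congr rfl fun i _ => ?_
  rw [ENNReal.ofReal_sum_of_nonneg (fun k _ => mul_self_nonneg _)]
  refine Finset.sum_congr rfl fun k _ => ?_
  rw [coe_nnnorm_sq_eq_ofReal, Real.norm_eq_abs, sq_abs, sq]

/-- The kinetic density of a complexified real function is its real carré du champ:
`|∇(f : ℂ)|² = ofReal (∇f·∇f)`. [folklore] -/
theorem kineticDensity_ofReal_eq (f : Config N → ℝ) (X : Config N) :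
    kineticDensity (fun Y => ((f Y : ℝ) : ℂ)) X = ENNReal.ofReal (gradDot f f X) := by
  unfold kineticDensity
  simp only [nnnorm_fderiv_ofReal_comp_apply]
  exact sum_nnnorm_fderiv_sq_eq f X

/-- The relative Fisher density of real amplitudes with non-vanishing reference in real form:
`4|∇(φ/ψ₀)|²ψ₀² = ofReal (4 (∇h·∇h) ψ₀²)`, `h = φ/ψ₀`. [folklore] -/
theorem relFisherDensity_eq_ofReal (φ ψ₀ : Config N → ℝ) (X : Config N) :
    relFisherDensity φ ψ₀ X =
      ENNReal.ofReal (4 * (gradDot (fun Y => φ Y / ψ₀ Y) (fun Y => φ Y / ψ₀ Y) X * ψ₀ X ^ 2)) := by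
  unfold relFisherDensity
  rw [sum_nnnorm_fderiv_sq_eq, ENNReal.ofReal_mul zero_le_four, ENNReal.ofReal_ofNat,
    ENNReal.ofReal_mul (gradDot_self_nonneg _ X), mul_assoc]

/-- `kineticDensity (c ψ) = |c|² kineticDensity ψ`. [folklore] -/
theorem kineticDensity_const_mul' (c : ℂ) (ψ : Config N → ℂ) (X : Config N) :
    kineticDensity (fun Y => c * ψ Y) X = (‖c‖₊ : ℝ≥0∞) ^ 2 * kineticDensity ψ X := by
  unfold kineticDensity
  rw [show (fun Y => c * ψ Y) = c • ψ from rfl, fderiv_const_smul_field, Finset.mul_sum]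
  refine Finset.sum_congr rfl fun i _ => ?_
  rw [Finset.mul_sum]
  refine Finset.sum_congr rfl fun k _ => ?_
  rw [Pi.smul_apply, _root_.smul_apply, smul_eq_mul, nnnorm_mul, ENNReal.coe_mul, mul_pow]

/-- Expansion of the carré du champ along `u + t v`:
`|∇(u + tv)|² = |∇u|² + 2t ∇v·∇u + t² |∇v|²` at points of differentiability. [folklore] -/
theorem gradDot_add_mul_self {u v : Config N → ℝ} {X : Config N} (hu : DifferentiableAt ℝ u X)
    (hv : DifferentiableAt ℝ v X) (t : ℝ) :
    gradDot (fun Y => u Y + t * v Y) (fun Y => u Y + t * v Y) X =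
      gradDot u u X + 2 * t * gradDot v u X + t ^ 2 * gradDot v v X := by
  have hp : ∀ (i : Fin N) (k : Fin 3), pderiv i k (fun Y => u Y + t * v Y) X =
      pderiv i k u X + t * pderiv i k v X := by
    intro i k
    unfold pderiv
    rw [fderiv_fun_add hu (hv.const_mul t), fderiv_const_mul hv]
    simp
  simp only [gradDot, hp, Finset.mul_sum, Finset.sum_add_distrib.symm]
  refine Finset.sum_congr rfl fun i _ => Finset.sum_congr rfl fun k _ => ?_
  ring

/-- **Jacobi's identity** (ground-state transform, pointwise):
`|∇(hψ)|² = ψ² |∇h|² + ∇(h²ψ)·∇ψ` at points of differentiability. [folklore] -/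
theorem gradDot_mul_self_eq {h ψ : Config N → ℝ} {X : Config N} (hh : DifferentiableAt ℝ h X)
    (hψ : DifferentiableAt ℝ ψ X) :
    gradDot (fun Y => h Y * ψ Y) (fun Y => h Y * ψ Y) X =
      ψ X ^ 2 * gradDot h h X + gradDot (fun Y => h Y * (h Y * ψ Y)) ψ X := by
  have hp1 : ∀ (i : Fin N) (k : Fin 3), pderiv i k (fun Y => h Y * ψ Y) X =
      h X * pderiv i k ψ X + ψ X * pderiv i k h X := by
    intro i k
    unfold pderiv
    rw [fderiv_fun_mul hh hψ]
    simp
  have hp2 : ∀ (i : Fin N) (k : Fin 3), pderiv i k (fun Y => h Y * (h Y * ψ Y)) X =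
      h X * (h X * pderiv i k ψ X + ψ X * pderiv i k h X) + h X * ψ X * pderiv i k h X := by
    intro i k
    unfold pderiv
    rw [fderiv_fun_mul hh (hh.fun_mul hψ), fderiv_fun_mul hh hψ]
    simp only [_root_.add_apply, _root_.smul_apply, smul_eq_mul]
  simp only [gradDot, hp1, hp2, Finset.mul_sum, Finset.sum_add_distrib.symm]
  refine Finset.sum_congr rfl fun i _ => Finset.sum_congr rfl fun k _ => ?_
  ring


/-! ### Real forms of the weighted energy on the cell -/

variable {L : ℝ} {W : Config N → ℝ≥0∞}

/-- The mass of a complexified real continuous function on the cell in real form: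
`∫⁻ ‖f‖₊² = ofReal ∫ f²`. [folklore] -/
theorem mass_ofReal_eq {f : Config N → ℝ} (hf : Continuous f) (L : ℝ) :
    ∫⁻ X in cellN N L, (‖((f X : ℝ) : ℂ)‖₊ : ℝ≥0∞) ^ 2 =
      ENNReal.ofReal (∫ X in cellN N L, f X ^ 2) := by
  rw [ofReal_integral_eq_lintegral_ofReal (integrableOn_cellN (f := fun X => f X ^ 2) (hf.pow 2) L)
    (ae_of_all _ fun X => sq_nonneg _)]
  exact lintegral_congr fun X => coe_nnnorm_ofReal_sq _

/-- Finite weighted mass `∫⁻ W ψ₀² < ∞` makes `W.toReal ψ₀² g` integrable on the cell for every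
continuous `g` (bounded on the bounded cell). [folklore] -/
theorem integrableOn_weight_mul (hWm : Measurable W) {ψ₀ : Config N → ℝ} (hψ₀ : Continuous ψ₀)
    (hfin : ∫⁻ X in cellN N L, W X * ENNReal.ofReal (ψ₀ X ^ 2) ≠ ⊤) {g : Config N → ℝ}
    (hg : Continuous g) :
    IntegrableOn (fun X => (W X).toReal * ψ₀ X ^ 2 * g X) (cellN N L) := by
  have hI : IntegrableOn (fun X => (W X).toReal * ψ₀ X ^ 2) (cellN N L) := by
    have hm : AEMeasurable (fun X => W X * ENNReal.ofReal (ψ₀ X ^ 2))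
        (volume.restrict (cellN N L)) :=
      (hWm.mul (ENNReal.measurable_ofReal.comp (hψ₀.measurable.pow_const 2))).aemeasurable
    refine (integrable_toReal_of_lintegral_ne_top hm hfin).congr (ae_of_all _ fun X => ?_)
    simp only [ENNReal.toReal_mul, ENNReal.toReal_ofReal (sq_nonneg _)]
  obtain ⟨C, hC⟩ := (isCompact_closedBall (0 : Config N) (2 * |L|)).exists_bound_of_continuousOn
    hg.continuousOn
  refine Integrable.mul_bdd (c := C) hI hg.aestronglyMeasurable ?_
  exact ae_restrict_of_forall_mem (measurableSet_cellN N L) fun X hX =>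
    hC X (cellN_subset_closedBall N L hX)

/-- Real form of the weighted energy of a complexified real `C¹` function with integrable
potential term: `∫⁻ (|∇f|² + W f²) = ofReal ∫ (∇f·∇f + W.toReal f²)`. [folklore] -/
theorem weightedForm_ofReal_eq (hWtop : ∀ X, W X ≠ ⊤) {f : Config N → ℝ} (hf : ContDiff ℝ 1 f)
    (hI : IntegrableOn (fun X => (W X).toReal * f X ^ 2) (cellN N L)) :
    ∫⁻ X in cellN N L, (kineticDensity (fun Y => ((f Y : ℝ) : ℂ)) X +
        W X * (‖((f X : ℝ) : ℂ)‖₊ : ℝ≥0∞) ^ 2) =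
      ENNReal.ofReal (∫ X in cellN N L, (gradDot f f X + (W X).toReal * f X ^ 2)) := by
  have hint : IntegrableOn (fun X => gradDot f f X + (W X).toReal * f X ^ 2) (cellN N L) :=
    (integrableOn_cellN (continuous_gradDot hf hf) L).add hI
  rw [ofReal_integral_eq_lintegral_ofReal hint (ae_of_all _ fun X =>
    add_nonneg (gradDot_self_nonneg f X) (mul_nonneg ENNReal.toReal_nonneg (sq_nonneg _)))]
  refine lintegral_congr fun X => ?_
  rw [ENNReal.ofReal_add (gradDot_self_nonneg f X) (mul_nonneg ENNReal.toReal_nonneg (sq_nonneg _)),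
    kineticDensity_ofReal_eq, ENNReal.ofReal_mul ENNReal.toReal_nonneg,
    ENNReal.ofReal_toReal (hWtop X), coe_nnnorm_ofReal_sq]

/-! ### The variational inequality for unnormalised functions -/

/-- **Scaling inequality for the weighted energy.** If `E₀` is a lower bound of the weighted
energy `∫⁻ (|∇Ψ|² + W|Ψ|²)` over all admissible periodic states, then for every `C¹`,
`Lℤ³`-periodic, Bose-symmetric `ψ` (not necessarily normalised)
`E₀ · ∫⁻ |ψ|² ≤ ∫⁻ (|∇ψ|² + W|ψ|²)` (normalise with `PeriodicTrialState.ofFun`; trivial if the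
mass vanishes). [cite: Fournais2020, (1.1)–(1.2)] -/
theorem lowerBound_mul_mass_le {E₀ : ℝ≥0∞}
    (hmin : ∀ Ψ : PeriodicTrialState N L,
      E₀ ≤ ∫⁻ X in cellN N L, (kineticDensity Ψ.ψ X + W X * (‖Ψ.ψ X‖₊ : ℝ≥0∞) ^ 2))
    {ψ : Config N → ℂ} (hC : ContDiff ℝ 1 ψ)
    (hper : ∀ (X : Config N) (i : Fin N) (a : Fin 3),
      ψ (X + Pi.single i (EuclideanSpace.single a L)) = ψ X)
    (hsymm : ∀ (σ : Equiv.Perm (Fin N)) (X : Config N), ψ (X ∘ σ) = ψ X) :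
    E₀ * ∫⁻ X in cellN N L, (‖ψ X‖₊ : ℝ≥0∞) ^ 2 ≤
      ∫⁻ X in cellN N L, (kineticDensity ψ X + W X * (‖ψ X‖₊ : ℝ≥0∞) ^ 2) := by
  have hmtop : (∫⁻ X in cellN N L, (‖ψ X‖₊ : ℝ≥0∞) ^ 2) ≠ ⊤ :=
    lintegral_cellN_normSq_ne_top hC.continuous L
  rcases eq_or_ne (∫⁻ X in cellN N L, (‖ψ X‖₊ : ℝ≥0∞) ^ 2) 0 with hm0 | hm0
  · rw [hm0, mul_zero]
    exact zero_le
  have hmpos : 0 < (∫⁻ X in cellN N L, (‖ψ X‖₊ : ℝ≥0∞) ^ 2).toReal := ENNReal.toReal_pos hm0 hmtop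
  -- the normalising constant
  have hc2 : ((‖((Real.sqrt (∫⁻ X in cellN N L, (‖ψ X‖₊ : ℝ≥0∞) ^ 2).toReal)⁻¹ : ℂ)‖₊ : ℝ≥0∞)) ^ 2 =
      (∫⁻ X in cellN N L, (‖ψ X‖₊ : ℝ≥0∞) ^ 2)⁻¹ := by
    rw [coe_nnnorm_sq_eq_ofReal, norm_inv, Complex.norm_real, Real.norm_of_nonneg (Real.sqrt_nonneg _),
      inv_pow, Real.sq_sqrt hmpos.le, ENNReal.ofReal_inv_of_pos hmpos, ENNReal.ofReal_toReal hmtop]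
  -- the weighted energy of the normalised state `ψ/‖ψ‖`
  have hE : (∫⁻ X in cellN N L, (kineticDensity (PeriodicTrialState.ofFun ψ hC hper hsymm hm0 hmtop).ψ X +
      W X * (‖(PeriodicTrialState.ofFun ψ hC hper hsymm hm0 hmtop).ψ X‖₊ : ℝ≥0∞) ^ 2)) =
      (∫⁻ X in cellN N L, (‖ψ X‖₊ : ℝ≥0∞) ^ 2)⁻¹ *
        ∫⁻ X in cellN N L, (kineticDensity ψ X + W X * (‖ψ X‖₊ : ℝ≥0∞) ^ 2) := by
    rw [← hc2, ← lintegral_const_mul' _ _ (ENNReal.pow_ne_top ENNReal.coe_ne_top)]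
    refine lintegral_congr fun X => ?_
    change kineticDensity (fun Z => ((Real.sqrt (∫⁻ X in cellN N L,
        (‖ψ X‖₊ : ℝ≥0∞) ^ 2).toReal)⁻¹ : ℂ) * ψ Z) X + W X *
      ((‖((Real.sqrt (∫⁻ X in cellN N L, (‖ψ X‖₊ : ℝ≥0∞) ^ 2).toReal)⁻¹ : ℂ) * ψ X‖₊ : ℝ≥0∞)) ^ 2 = _
    rw [kineticDensity_const_mul', nnnorm_mul, ENNReal.coe_mul, mul_pow]
    ring
  calc E₀ * ∫⁻ X in cellN N L, (‖ψ X‖₊ : ℝ≥0∞) ^ 2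
      ≤ (∫⁻ X in cellN N L, (kineticDensity (PeriodicTrialState.ofFun ψ hC hper hsymm hm0 hmtop).ψ X +
          W X * (‖(PeriodicTrialState.ofFun ψ hC hper hsymm hm0 hmtop).ψ X‖₊ : ℝ≥0∞) ^ 2)) *
          ∫⁻ X in cellN N L, (‖ψ X‖₊ : ℝ≥0∞) ^ 2 :=
        mul_le_mul' (hmin _) le_rfl
    _ = _ := by
        rw [hE, mul_comm _⁻¹, mul_assoc, ENNReal.inv_mul_cancel hm0 hmtop, mul_one]

/-- **Real form of the variational inequality** for a complexified real `C¹` periodic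
Bose-symmetric `f` with integrable potential term and finite lower bound `E₀`:
`E₀.toReal · ∫ f² ≤ ∫ (∇f·∇f + W.toReal f²)`. [cite: Fournais2020, (1.1)–(1.2)] -/
theorem toReal_lowerBound_mul_le {E₀ : ℝ≥0∞} (hE₀ : E₀ ≠ ⊤) (hWtop : ∀ X, W X ≠ ⊤)
    (hmin : ∀ Ψ : PeriodicTrialState N L,
      E₀ ≤ ∫⁻ X in cellN N L, (kineticDensity Ψ.ψ X + W X * (‖Ψ.ψ X‖₊ : ℝ≥0∞) ^ 2))
    {f : Config N → ℝ} (hf : ContDiff ℝ 1 f)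
    (hper : ∀ (X : Config N) (i : Fin N) (a : Fin 3),
      f (X + Pi.single i (EuclideanSpace.single a L)) = f X)
    (hsymm : ∀ (σ : Equiv.Perm (Fin N)) (X : Config N), f (X ∘ σ) = f X)
    (hI : IntegrableOn (fun X => (W X).toReal * f X ^ 2) (cellN N L)) :
    E₀.toReal * ∫ X in cellN N L, f X ^ 2 ≤
      ∫ X in cellN N L, (gradDot f f X + (W X).toReal * f X ^ 2) := by
  have hCc : ContDiff ℝ 1 fun Y => ((f Y : ℝ) : ℂ) := Complex.ofRealCLM.contDiff.comp hf
  have h := lowerBound_mul_mass_le hmin hCc (fun X i a => by simp only [hper])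
    (fun σ X => by simp only [hsymm])
  rw [mass_ofReal_eq hf.continuous, weightedForm_ofReal_eq hWtop hf hI, ← ENNReal.ofReal_toReal hE₀,
    ← ENNReal.ofReal_mul ENNReal.toReal_nonneg,
    ENNReal.ofReal_le_ofReal_iff (integral_nonneg fun X => add_nonneg (gradDot_self_nonneg f X)
      (mul_nonneg ENNReal.toReal_nonneg (sq_nonneg _)))] at h
  exact h

/-- `∫ (A + 2tB + t²C) = ∫A + 2t∫B + t²∫C` for integrable `A, B, C`. [folklore] -/
theorem integral_quadratic_expand {s : Set (Config N)} {A B C : Config N → ℝ}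
    (hA : IntegrableOn A s) (hB : IntegrableOn B s) (hC : IntegrableOn C s) (t : ℝ) :
    ∫ X in s, (A X + 2 * t * B X + t ^ 2 * C X) =
      (∫ X in s, A X) + 2 * t * (∫ X in s, B X) + t ^ 2 * ∫ X in s, C X := by
  have h1 : Integrable (fun X => A X + 2 * t * B X) (volume.restrict s) := hA.add (hB.const_mul _)
  rw [integral_add h1 (hC.const_mul _), integral_add hA (hB.const_mul _), integral_const_mul,
    integral_const_mul]


/-! ### From an arbitrary pair potential to a measurable weight -/

/-- **Reduction to a measurable weight.** For an *arbitrary* pair-potential profile `v` (no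
measurability assumed) and a nowhere-vanishing admissible periodic state `Ψ₀` with finite
potential energy, there is a measurable finite weight `G ≤ ∑_{i<j} v^per(xᵢ - xⱼ)` such that the
periodic energy of *every* admissible periodic state is the `G`-weighted energy
`∫⁻_{cell} (|∇Ψ|² + G|Ψ|²)` (the lower Lebesgue integral of the possibly non-measurable
interaction term is the integral against the measurable minorant, `exists_measurable_minorant`;
the kinetic term is measurable and splits off). [folklore] -/
theorem exists_measurable_weight (v : ℝ → ℝ≥0∞) (Ψ₀ : PeriodicTrialState N L)
    (h0 : ∀ X, Ψ₀.ψ X ≠ 0)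
    (hfin : ∫⁻ X in cellN N L, periodicInteraction v L X * (‖Ψ₀.ψ X‖₊ : ℝ≥0∞) ^ 2 ≠ ⊤) :
    ∃ G : Config N → ℝ≥0∞, Measurable G ∧ (∀ X, G X ≤ periodicInteraction v L X) ∧
      (∀ X, G X ≠ ⊤) ∧ ∀ Ψ : PeriodicTrialState N L, periodicEnergy v Ψ =
        ∫⁻ X in cellN N L, (kineticDensity Ψ.ψ X + G X * (‖Ψ.ψ X‖₊ : ℝ≥0∞) ^ 2) := by
  have hp : Measurable fun X => ((‖Ψ₀.ψ X‖₊ : ℝ≥0∞)) ^ 2 :=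
    (Ψ₀.contDiff.continuous.measurable.nnnorm.coe_nnreal_ennreal).pow_const _
  have hp0 : ∀ X, ((‖Ψ₀.ψ X‖₊ : ℝ≥0∞)) ^ 2 ≠ 0 := fun X =>
    pow_ne_zero 2 (ENNReal.coe_ne_zero.mpr (nnnorm_ne_zero_iff.mpr (h0 X)))
  have hptop : ∀ X, ((‖Ψ₀.ψ X‖₊ : ℝ≥0∞)) ^ 2 ≠ ⊤ := fun X => ENNReal.pow_ne_top ENNReal.coe_ne_top
  obtain ⟨G, hGm, hGle, hGtop, hGeq⟩ := exists_measurable_minorant (volume.restrict (cellN N L))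
    (fun X => periodicInteraction v L X) hp hp0 hptop hfin
  refine ⟨G, hGm, hGle, hGtop, fun Ψ => ?_⟩
  have ha : Measurable fun X => ((‖Ψ.ψ X‖₊ : ℝ≥0∞)) ^ 2 :=
    (Ψ.contDiff.continuous.measurable.nnnorm.coe_nnreal_ennreal).pow_const _
  unfold periodicEnergy
  rw [lintegral_add_left (measurable_kineticDensity_of_any Ψ.ψ),
    lintegral_add_left (measurable_kineticDensity_of_any Ψ.ψ),
    hGeq _ ha fun X => ENNReal.pow_ne_top ENNReal.coe_ne_top]

end FisherGroundStateRepresentation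

end Summit.AtomisticToContinuum.BoseEinsteinCondensation.Theorems

end
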